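import Summits.CriticalPhenomena.CardyFormulaZ2.Theses.CardyUSTContinuation
import Summits.CriticalPhenomena.CardyFormulaZ2.Theorems.CardyUSTContinuationSmallFugacityLimitContinuumChecks
import Literature.Probability.RandomPlanarGeometry.ConformalRectangleProofs

/-!
# Skeleton for the crux `CardyUSTContinuation.SmallFugacityLimit` — line `registered` (birth), reshaped by lead c4
(item `stmt-CriticalPhenomena-6048`, route `route-CriticalPhenomena-CardyUSTContinuation`, sub `CardyFormulaZ2`)

Registered by `planner-skel-stmt-CriticalPhenomena-6048-0` (2026-08-17) as `Cruxes/SmallFugacityLimit/Lines/birth.lean`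
with three stubs `stub_scalingLimitExists` / `stub_conformalInvariance` / `stub_dictionaryMW`; RESHAPED by lead c4
(`prover-line-stmt-CriticalPhenomena-6048-c4-0`, 2026-08-17): the existence storey `stub_scalingLimitExists` is split
into its PROVABLE part `stub_unitInterval` (the crossing probabilities are genuine probabilities: `uJ R t δ ∈ [0,1]`
for `t > 0`, because `fkDomainMeasure` is a probability measure at `p = t/(1+t) ∈ [0,1]`, `q = t² > 0`) and its OPEN
part `stub_uniqueClusterPoint` (at most one subsequential limit of `δ ↦ uJ R t δ` at `0⁺`); existence follows by
compactness of `[0,1]` (`scalingLimitExists_of`, sorry-free, `IsCompact.tendsto_nhds_of_unique_mapClusterPt`).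
This is the standard "precompactness + identification of subsequential limits" entry point of every scaling-limit
theorem (Smirnov 2001 §2; for a single real sequence precompactness is free, which is exactly what the split records).
The objects `Zmw`, `Umw`, `uJ` are now the abbrevs of the landed helper file
`Theorems/CardyUSTContinuationSmallFugacityLimitContinuumChecks.lean` (namespace `…Theorems.SmallFugacityContinuum`,
verbatim the crux's `let`s, `smallFugacityLimit_iff_Umw : crux ↔ … := Iff.rfl`), so that landed stubs match the
skeleton syntactically.

THE CRUX (verbatim, see `smallFugacityLimit_iff`): for every conformal rectangle `R` there is
`t₀ > 0` such that for every `t ∈ (0, t₀)` the jointly-wired self-dual FK(`q = t²`) crossing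
probability `uJ R t δ` of G02's discretisation `Ω_δ` has crossing limit `U(t, ·)` as `δ → 0⁺`
(`R.HasCrossingLimit`), `U(t, η) = t Z(η)/(Z(1−η) + t Z(η))` the Miller–Werner CLE_κ(t)
connection function in joint wiring, `κ(t) = 4π/arccos(−t/2)`.

THE LINE (four stubs; `t₀` uniform in `R` in the first three):

* `stub_unitInterval` — PROVABLE NOW: `uJ R t δ ∈ [0, 1]` for every `R`, `δ` and `t > 0`
  (`isProbabilityMeasure_fkDomainMeasure`; for `δ ≤ 0` the junk value is `0 ∈ [0,1]`).
* `stub_uniqueClusterPoint` — OPEN (the existence engine; route two-layer plan `UniformSmallT`): there is `t₀ > 0`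
  such that for every conformal rectangle `R` and every `t ∈ (0, t₀)` the function `δ ↦ uJ R t δ` has at most one
  cluster value along `𝓝[>] 0`. With `stub_unitInterval` this is equivalent to the former `stub_scalingLimitExists`.
  Nothing in print gives it for any `q ∈ (0,1)` (arXiv:2603.06268 p.11: no FKG/RSW for `q < 1`).
* `stub_conformalInvariance` — OPEN, unchanged: equal cross-ratio ⇒ equal limit values, `t ∈ (0, t₀)`.
* `stub_dictionaryMW` — OPEN, unchanged: a universal crossing-limit function on `(0, t₀)` is `U(t, ·)` for small `t`.

`SmallFugacityLimit_of` composes the four stubs (hypotheses `Registered.stub_*`) into the crux BY NAME with no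
`sorry`: existence by compactness, a universal limit function `limitFn` built by `Classical.epsilon` from
existence + invariance, fed to the dictionary; the crux's `t₀` is `min (min t₁ t₂) t₃`.

Consistency (sorry-free, § at the end): the uniform-`t₀` crux implies every open stub (uniqueness of limits along
the non-trivial filter `𝓝[>] 0`, plus the tree's PROVED existence of uniformizing data
`MarkedDomain.exists_isUniformizing_holds`), and `stub_unitInterval` is true outright; so no stub is false unless
the uniform crux is.

Disproof used: none exists (`ledger crux ls stmt-CriticalPhenomena-6048`: no `Disproof.lean`; no
`Theorems/SmallFugacityLimit/Negative/`); `ledger negatives --problem CriticalPhenomena` (11 entries) has nothing on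
FK(`q < 1`) crossing limits. Numerical support: `Cruxes/SmallFugacityLimit/NUMERICS-falsifier3.md` (lead c3: exact
transfer-matrix box crossing probabilities agree with `U(t, η(r))` to ≤ 3.4e-8 for `t ≤ 0.5`).
-/

noncomputable section

namespace Summit.CriticalPhenomena.CardyFormulaZ2.Cruxes.SmallFugacityLimit.Birth

open Filter Set Topology
open Literature.Probability.RandomPlanarGeometry (ConformalRectangle ConformalEquiv crossRatio)
open Literature.Probability.LatticeModels (fkDomainMeasure meshDomain_finite)
open Literature.Probability.Percolation (discreteCrossing)
open Summit.CriticalPhenomena.CardyFormulaZ2.Theorems.SmallFugacityContinuum (Zmw Umw uJ)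

/-! ## The crux, definitionally (the objects `Zmw`, `Umw`, `uJ` are the landed abbrevs = the crux's `let`s) -/

/-- The crux, definitionally. -/
theorem smallFugacityLimit_iff :
    Summit.CriticalPhenomena.CardyFormulaZ2.Theses.CardyUSTContinuation.SmallFugacityLimit ↔
      ∀ R : ConformalRectangle, ∃ t₀ > (0:ℝ), ∀ t ∈ Set.Ioo 0 t₀,
        R.HasCrossingLimit (fun δ => uJ R t δ) (Umw t) :=
  Iff.rfl

/-! ## The stub STATEMENTS (named `Prop`s; the registered `stub_*` theorems below restate them verbatim,
and `Registered.stub_*` are the name-keyed aliases used as the hypotheses of `SmallFugacityLimit_of`) -/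

/-- STUB 1a statement (provable) — the crossing probabilities lie in `[0, 1]` for `t > 0`. -/
abbrev UnitInterval : Prop :=
  ∀ (R : ConformalRectangle) (t δ : ℝ), 0 < t → uJ R t δ ∈ Set.Icc (0:ℝ) 1

/-- STUB 1b statement (open) — at most one subsequential limit at `0⁺`, for all conformal rectangles, on one
interval of small defect fugacity `t = √q`. -/
abbrev UniqueClusterPoint : Prop :=
  ∃ t₀ > (0:ℝ), ∀ R : ConformalRectangle, ∀ t ∈ Set.Ioo 0 t₀, ∀ L L' : ℝ,
    MapClusterPt L (𝓝[>] 0) (fun δ => uJ R t δ) → MapClusterPt L' (𝓝[>] 0) (fun δ => uJ R t δ) → L = L'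

/-- Former STUB 1 statement (now DERIVED from 1a + 1b) — existence of the scaling limit of the jointly-wired
crossing probability, for all conformal rectangles, on one interval of small `t`. -/
abbrev ScalingLimitExists : Prop :=
  ∃ t₀ > (0:ℝ), ∀ R : ConformalRectangle, ∀ t ∈ Set.Ioo 0 t₀,
    ∃ L : ℝ, Tendsto (fun δ => uJ R t δ) (𝓝[>] 0) (𝓝 L)

/-- STUB 2 statement — conformal invariance of the limit values: two conformal rectangles with
uniformizing data of equal cross-ratio have equal crossing limits (when these exist), for all
`t` in one interval of small fugacity. -/
abbrev ConformalInvariance : Prop :=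
  ∃ t₀ > (0:ℝ), ∀ (R R' : ConformalRectangle), ∀ t ∈ Set.Ioo 0 t₀, ∀ L L' : ℝ,
    Tendsto (fun δ => uJ R t δ) (𝓝[>] 0) (𝓝 L) → Tendsto (fun δ => uJ R' t δ) (𝓝[>] 0) (𝓝 L') →
    ∀ (φ : ConformalEquiv UpperHalfPlane.upperHalfPlaneSet R.carrier)
      (x : Fin 4 → ℝ)
      (φ' : ConformalEquiv UpperHalfPlane.upperHalfPlaneSet R'.carrier)
      (x' : Fin 4 → ℝ),
      R.IsUniformizing φ x → R'.IsUniformizing φ' x' → crossRatio x = crossRatio x' → L = L'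

/-- STUB 3 statement — the Miller–Werner dictionary: a universal crossing-limit function of the
jointly-wired self-dual FK(`t²`) model on `(0, t₀)` is `U(t, ·)` at every realised cross-ratio, for
all sufficiently small `t`. -/
abbrev DictionaryMW : Prop :=
  ∀ (t₀ : ℝ) (V : ℝ → ℝ → ℝ), 0 < t₀ →
    (∀ R : ConformalRectangle, ∀ t ∈ Set.Ioo 0 t₀, R.HasCrossingLimit (fun δ => uJ R t δ) (V t)) →
    ∃ t₁ > (0:ℝ), ∀ t ∈ Set.Ioo 0 t₁, t < t₀ → ∀ (R : ConformalRectangle)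
      (φ : ConformalEquiv UpperHalfPlane.upperHalfPlaneSet R.carrier)
      (x : Fin 4 → ℝ), R.IsUniformizing φ x → V t (crossRatio x) = Umw t (crossRatio x)

/-! ## Registered stubs -/

/-- stub 1a (provable now): the crossing probabilities are genuine probabilities for `t > 0`. -/
theorem stub_unitInterval : ∀ (R : ConformalRectangle) (t δ : ℝ), 0 < t → uJ R t δ ∈ Set.Icc (0:ℝ) 1 := by
  sorry

/-- stub 1b (open): at most ONE cluster value of `δ ↦ uJ R t δ` along `𝓝[>] 0`, for every `R`, `t ∈ (0, t₀)`. -/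
theorem stub_uniqueClusterPoint : ∃ t₀ > (0:ℝ), ∀ R : ConformalRectangle, ∀ t ∈ Set.Ioo 0 t₀, ∀ L L' : ℝ,
    MapClusterPt L (𝓝[>] 0) (fun δ => uJ R t δ) → MapClusterPt L' (𝓝[>] 0) (fun δ => uJ R t δ) →
    L = L' := by
  sorry

/-- stub 2: CONFORMAL INVARIANCE of the limit values (equal cross-ratio ⇒ equal limit). -/
theorem stub_conformalInvariance : ∃ t₀ > (0:ℝ), ∀ (R R' : ConformalRectangle), ∀ t ∈ Set.Ioo 0 t₀,
    ∀ L L' : ℝ,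
    Tendsto (fun δ => uJ R t δ) (𝓝[>] 0) (𝓝 L) → Tendsto (fun δ => uJ R' t δ) (𝓝[>] 0) (𝓝 L') →
    ∀ (φ : ConformalEquiv UpperHalfPlane.upperHalfPlaneSet R.carrier)
      (x : Fin 4 → ℝ)
      (φ' : ConformalEquiv UpperHalfPlane.upperHalfPlaneSet R'.carrier)
      (x' : Fin 4 → ℝ),
      R.IsUniformizing φ x → R'.IsUniformizing φ' x' → crossRatio x = crossRatio x' → L = L' := by
  sorry

/-- stub 3: the MILLER–WERNER DICTIONARY for universal crossing-limit functions. -/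
theorem stub_dictionaryMW : ∀ (t₀ : ℝ) (V : ℝ → ℝ → ℝ), 0 < t₀ →
    (∀ R : ConformalRectangle, ∀ t ∈ Set.Ioo 0 t₀, R.HasCrossingLimit (fun δ => uJ R t δ) (V t)) →
    ∃ t₁ > (0:ℝ), ∀ t ∈ Set.Ioo 0 t₁, t < t₀ → ∀ (R : ConformalRectangle)
      (φ : ConformalEquiv UpperHalfPlane.upperHalfPlaneSet R.carrier)
      (x : Fin 4 → ℝ), R.IsUniformizing φ x → V t (crossRatio x) = Umw t (crossRatio x) := by
  sorry

/-! ## Name-keyed aliases of the statements (the hypotheses of the composition) -/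
namespace Registered

/-- Alias of `UnitInterval`, keyed by the registered stub name. -/
abbrev stub_unitInterval : Prop := UnitInterval
/-- Alias of `UniqueClusterPoint`, keyed by the registered stub name. -/
abbrev stub_uniqueClusterPoint : Prop := UniqueClusterPoint
/-- Alias of `ConformalInvariance`, keyed by the registered stub name. -/
abbrev stub_conformalInvariance : Prop := ConformalInvariance
/-- Alias of `DictionaryMW`, keyed by the registered stub name. -/
abbrev stub_dictionaryMW : Prop := DictionaryMW

end Registered

/-! Sanity: the registered stubs prove exactly the aliased statements. -/
example : Registered.stub_unitInterval := stub_unitInterval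
example : Registered.stub_uniqueClusterPoint := stub_uniqueClusterPoint
example : Registered.stub_conformalInvariance := stub_conformalInvariance
example : Registered.stub_dictionaryMW := stub_dictionaryMW

/-! ## The composition (no `sorry`): stubs ⇒ the crux BY NAME -/

/-- Existence of the scaling limit from boundedness (stub 1a) and uniqueness of the cluster value (stub 1b):
`[0,1]` is compact, the filter `𝓝[>] 0` is non-trivial, so a cluster value exists
(`IsCompact.exists_mapClusterPt_of_frequently`) and a function with values in a compact set and a unique cluster
value converges to it (`IsCompact.tendsto_nhds_of_unique_mapClusterPt`). -/
theorem scalingLimitExists_of (hB : Registered.stub_unitInterval) (hU : Registered.stub_uniqueClusterPoint) :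
    ScalingLimitExists := by
  obtain ⟨t₀, ht₀, hU⟩ := hU
  refine ⟨t₀, ht₀, fun R t ht => ?_⟩
  have hmem : ∀ᶠ δ in 𝓝[>] (0:ℝ), uJ R t δ ∈ Icc (0:ℝ) 1 :=
    Eventually.of_forall fun δ => hB R t δ ht.1
  obtain ⟨L, -, hL⟩ := isCompact_Icc.exists_mapClusterPt_of_frequently hmem.frequently
  exact ⟨L, isCompact_Icc.tendsto_nhds_of_unique_mapClusterPt hmem fun x _ hx => hU R t ht x L hx hL⟩

/-- The universal limit function built from existence + invariance: at `(t, η)`, some limit value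
of `uJ R t` over some conformal rectangle `R` admitting a uniformizing datum of cross-ratio `η`
(junk elsewhere). -/
def limitFn : ℝ → ℝ → ℝ := fun t η =>
  Classical.epsilon fun L : ℝ => ∃ (R : ConformalRectangle)
    (φ : ConformalEquiv UpperHalfPlane.upperHalfPlaneSet R.carrier)
    (x : Fin 4 → ℝ), R.IsUniformizing φ x ∧ crossRatio x = η ∧
      Tendsto (fun δ => uJ R t δ) (𝓝[>] 0) (𝓝 L)

theorem SmallFugacityLimit_of (hB : Registered.stub_unitInterval) (hU : Registered.stub_uniqueClusterPoint)
    (hCI : Registered.stub_conformalInvariance) (hDict : Registered.stub_dictionaryMW) :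
    Summit.CriticalPhenomena.CardyFormulaZ2.Theses.CardyUSTContinuation.SmallFugacityLimit := by
  obtain ⟨t₁, ht₁, hEx⟩ := scalingLimitExists_of hB hU
  obtain ⟨t₂, ht₂, hCI⟩ := hCI
  -- Step 1: on (0, min t₁ t₂) the epsilon-built `limitFn` is a universal crossing-limit function.
  have hV : ∀ R : ConformalRectangle, ∀ t ∈ Set.Ioo 0 (min t₁ t₂),
      R.HasCrossingLimit (fun δ => uJ R t δ) (limitFn t) := by
    intro R t ht φ x hφ
    have ht1 : t ∈ Set.Ioo 0 t₁ := ⟨ht.1, lt_of_lt_of_le ht.2 (min_le_left _ _)⟩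
    have ht2 : t ∈ Set.Ioo 0 t₂ := ⟨ht.1, lt_of_lt_of_le ht.2 (min_le_right _ _)⟩
    obtain ⟨L, hL⟩ := hEx R t ht1
    -- the defining predicate of `limitFn t (crossRatio x)` is inhabited (witness `R, φ, x, L`)
    have hP : ∃ L' : ℝ, ∃ (R' : ConformalRectangle)
        (φ' : ConformalEquiv UpperHalfPlane.upperHalfPlaneSet R'.carrier)
        (x' : Fin 4 → ℝ), R'.IsUniformizing φ' x' ∧ crossRatio x' = crossRatio x ∧
          Tendsto (fun δ => uJ R' t δ) (𝓝[>] 0) (𝓝 L') := ⟨L, R, φ, x, hφ, rfl, hL⟩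
    obtain ⟨R', φ', x', hφ', hcr, hL'⟩ := Classical.epsilon_spec hP
    -- invariance: the limit `L` for `R` equals the chosen limit for `R'`
    have hEq : L = limitFn t (crossRatio x) := hCI R R' t ht2 L _ hL hL' φ x φ' x' hφ hφ' hcr.symm
    rw [← hEq]
    exact hL
  -- Step 2: the dictionary identifies `limitFn` with `Umw` on a smaller interval.
  obtain ⟨t₃, ht₃, hId⟩ := hDict (min t₁ t₂) limitFn (lt_min ht₁ ht₂) hV
  -- Step 3: assemble the crux with `t₀ = min (min t₁ t₂) t₃`.
  rw [smallFugacityLimit_iff]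
  intro R
  refine ⟨min (min t₁ t₂) t₃, lt_min (lt_min ht₁ ht₂) ht₃, ?_⟩
  intro t ht φ x hφ
  have ht12 : t ∈ Set.Ioo 0 (min t₁ t₂) := ⟨ht.1, lt_of_lt_of_le ht.2 (min_le_left _ _)⟩
  have ht3 : t ∈ Set.Ioo 0 t₃ := ⟨ht.1, lt_of_lt_of_le ht.2 (min_le_right _ _)⟩
  have hlim := hV R t ht12 φ x hφ
  rw [hId t ht3 ht12.2 R φ x hφ] at hlim
  exact hlim

/-! ## Consistency (sorry-free): the uniform-`t₀` crux gives back every open stub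

`UniformCrux` is the crux with `t₀` chosen uniformly in `R` (it implies the crux trivially; that
implication is deliberately NOT stated here, so that `SmallFugacityLimit_of` is the only theorem of
this file concluding the crux). Stubs 1b, 2, 3 follow from it by uniqueness of limits / cluster values along
`𝓝[>] 0`, stub 1b and the former stub 1 using the tree's PROVED existence of uniformizing data
(`MarkedDomain.exists_isUniformizing_holds`, Riemann mapping + Carathéodory). So no open stub is false unless the
uniform crux is; stub 1a is provable outright. -/

/-- The crux with a uniform `t₀`. -/
def UniformCrux : Prop :=
  ∃ t₀ > (0:ℝ), ∀ R : ConformalRectangle, ∀ t ∈ Set.Ioo 0 t₀,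
    R.HasCrossingLimit (fun δ => uJ R t δ) (Umw t)

/-- A cluster value of a function converging along a filter is its limit (Hausdorff). -/
theorem eq_of_mapClusterPt_of_tendsto {α : Type*} {F : Filter α} {u : α → ℝ} {L a : ℝ}
    (hL : MapClusterPt L F u) (hu : Tendsto u F (𝓝 a)) : L = a := by
  have h : ClusterPt L (𝓝 a) := ClusterPt.mono hL hu
  exact eq_of_nhds_neBot h.neBot

theorem scalingLimitExists_of_uniformCrux : UniformCrux → ScalingLimitExists := by
  rintro ⟨t₀, ht₀, h⟩
  refine ⟨t₀, ht₀, fun R t ht => ?_⟩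
  obtain ⟨φ, x, hφ⟩ :=
    Literature.Probability.RandomPlanarGeometry.MarkedDomain.exists_isUniformizing_holds R
  exact ⟨_, h R t ht φ x hφ⟩

theorem uniqueClusterPoint_of_uniformCrux : UniformCrux → UniqueClusterPoint := by
  rintro ⟨t₀, ht₀, h⟩
  refine ⟨t₀, ht₀, fun R t ht L L' hL hL' => ?_⟩
  obtain ⟨φ, x, hφ⟩ :=
    Literature.Probability.RandomPlanarGeometry.MarkedDomain.exists_isUniformizing_holds R
  have hT := h R t ht φ x hφ
  rw [eq_of_mapClusterPt_of_tendsto hL hT, eq_of_mapClusterPt_of_tendsto hL' hT]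

theorem conformalInvariance_of_uniformCrux : UniformCrux → ConformalInvariance := by
  rintro ⟨t₀, ht₀, h⟩
  refine ⟨t₀, ht₀, fun R R' t ht L L' hL hL' φ x φ' x' hφ hφ' hcr => ?_⟩
  have h1 : L = Umw t (crossRatio x) := tendsto_nhds_unique hL (h R t ht φ x hφ)
  have h2 : L' = Umw t (crossRatio x') := tendsto_nhds_unique hL' (h R' t ht φ' x' hφ')
  rw [h1, h2, hcr]

theorem dictionaryMW_of_uniformCrux : UniformCrux → DictionaryMW := by
  rintro ⟨t₀', ht₀', h⟩ t₀ V _ hV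
  refine ⟨t₀', ht₀', fun t ht htt R φ x hφ => ?_⟩
  exact tendsto_nhds_unique (hV R t ⟨ht.1, htt⟩ φ x hφ) (h R t ht φ x hφ)

end Summit.CriticalPhenomena.CardyFormulaZ2.Cruxes.SmallFugacityLimit.Birth

end
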